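import Summits.CriticalPhenomena.PercolationContinuityZ3.Theorems.PercNearOneGluingNoHeavyLowerTailAPLVwDVHardness
import Literature.Probability.LatticeModels.ProdBernoulliIndependence
import HarnessLib

/-!
# `NoHeavyLowerTail` (stmt-CriticalPhenomena-4575) — (V_w) for TWO loaded vertices holds on every finite weighted graph
# (Harris alone), and the SHARP form (V_w⁺) for two loaded vertices is a three-point inequality of Gladkov type

Support file (prover prim-ineq-gen-8 gen 51; `--supports stmt-CriticalPhenomena-4575`; memo
run/shared/lean/prim/prim-ineq-gen-8/FINDING-gen51-TWOLOAD.md §1–§2).  No definitions, no named facts, no sorries.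

SETTING (as in `…APLVwStep.lean`, `…APLVwDVHardness.lean`).  Bond percolation `μ = prodBernoulli w` on a finite vertex type,
apex `s`, `K = C(s)`, loads `ℓ ≥ 0`, `L = Σ ℓ_z 1[s↔z]`, `R = Σ_{clusters C ≠ K} ℓ(C)²`, `W = Σ_z ℓ_z Cov(1[s↔z], L)²/μ(s↔z)`,
`Φ = Σ_z ℓ_z³ μ(s↔z)(1 − μ(s↔z)²)`.  Conjectures of the lineage (memos gen 40/41): (V_w) `W ≤ 2|Cov(L,R)|` (⟹ (V) ⟹ with (P): (Q0))
and the sharp (V_w⁺) `W + Φ ≤ 2|Cov(L,R)|` (equality on every star).  Put the loads `x ≥ 0` at `u`, `y ≥ 0` at `b` and `0`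
elsewhere, and write `p = μ(s↔u)`, `π = μ(s↔b)`, `τ = μ(s↔u ∩ s↔b)`, `m = μ(u↔b ∩ (s↔u)ᶜ)` (`u, b` joined off the cluster),
`c = τ − pπ = Cov(1[s↔u],1[s↔b])`.  Elementary bookkeeping (memo §1; `R = x²1[s↮u] + y²1[s↮b] + 2xy·1[u↔b, s↮u]`) gives
  `W = x(x p(1−p) + y c)²/p + y(y π(1−π) + x c)²/π`,
  `2|Cov(L,R)| = 2x³p(1−p) + 2y³π(1−π) + 2xy c (x+y) + 4xy m (x p + y π)`,   `Φ = x³p(1−p²) + y³π(1−π²)`.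

THIS FILE proves [this work]:
* `twoLoad_gap_identity` (ring): `pπ·(2|C| − W) = π p²(1−p²)x³ + p π²(1−π²)y³ + (2pπ c + 4pπ m − c²)·xy(px+πy)`;
  `twoLoad_plus_identity` (ring): `pπ·(W + Φ − 2|C|) = (c² − 2pπ c − 4pπ m)·xy(px+πy)`.
* `twoLoad_gap_nonneg` (real algebra): `0 ≤ π ≤ 1`, `0 ≤ p ≤ 1`, `pπ ≤ τ ≤ min(p,π)`, `m, x, y ≥ 0` ⟹ `pπ·W ≤ pπ·2|C|`.
  Proof: concavity in `c` reduces to `c ∈ {0, min(p,π) − pπ}`; at the nontrivial endpoint (say `π ≤ p`)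
  `p·gap = π(1−p²)(px+πy)(px−πy)² + π²(p²−π²)y³ + 4p²π²(1−p)xy(px+πy) ≥ 0`.
* **`twoLoad_vw`**: for bond percolation on EVERY finite weighted graph and all `s, u, b`, `x, y ≥ 0`: the displayed (V_w)
  inequality (multiplied by `pπ`), the only probabilistic input being Harris `τ ≥ pπ` (`prodBernoulli_harris`) and `τ ≤ p, π`.
  By Cauchy–Schwarz this is (V) `Var(L)² ≤ 2 E[L]|Cov(L,R)|` for two-vertex loads, and with the proved (P)
  (`APL.kappa3_add_three_cov_nonpos`) also (Q0) and `E3(θ) ≤ 0` — previously known on all graphs only for forests.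
* `vwPlus_twoLoad_iff_threePoint`: the pair coefficient `c² − 2pπ c − 4pπ m ≤ 0` of (V_w⁺) is EQUIVALENT to the three-point
  inequality `τ² + 3p²π² ≤ 4pπ(τ+m)` (note `τ + m = μ(u↔b)`); `gladkov4_of_threePoint`: it implies `τ² ≤ 4 p π μ(u↔b)`, i.e.
  `μ(s↔u↔b)² ≤ 4 μ(s↔u)μ(s↔b)μ(u↔b)` (the published constant is `8`: Gladkov, arXiv:2408.08457, Thm 6.2); and
  `threePoint_of_gladkov3`: conversely the same inequality with constant `3` implies it.  So the sharp (V_w⁺), already for two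
  loads, is sandwiched between two Gladkov-type constants (memo §2), exactly as (PV) was shown DV-hard in `…APLVwDVHardness.lean`.
-/

noncomputable section

namespace Summit.CriticalPhenomena.PercolationContinuityZ3.Theorems

namespace APL

open MeasureTheory Set Literature.Probability.Percolation Literature.Probability.LatticeModels
open scoped Classical

/-! ### Real algebra -/

/-- **Gap identity** for the two-load (V_w) functional (memo §1): with `c = τ − pπ`,
`pπ·2|C| − pπ·W = π p²(1−p²)x³ + p π²(1−π²)y³ + (2pπc + 4pπm − c²)·xy(px+πy)`. [this work] -/
theorem twoLoad_gap_identity (p π c m x y : ℝ) :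
    p * π * (2 * x ^ 3 * p * (1 - p) + 2 * y ^ 3 * π * (1 - π) + 2 * x * y * c * (x + y) + 4 * x * y * m * (x * p + y * π))
      - (π * (x * (x * p * (1 - p) + y * c) ^ 2) + p * (y * (y * π * (1 - π) + x * c) ^ 2))
      = π * p ^ 2 * (1 - p ^ 2) * x ^ 3 + p * π ^ 2 * (1 - π ^ 2) * y ^ 3
        + (2 * p * π * c + 4 * p * π * m - c ^ 2) * (x * y * (p * x + π * y)) := by
  ring

/-- **Sharp-form identity** (memo §2): with `Φ = x³p(1−p²) + y³π(1−π²)`,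
`pπ·(W + Φ − 2|C|) = (c² − 2pπc − 4pπm)·xy(px+πy)` — the cubic terms cancel exactly, so (V_w⁺) for two loads is the sign of
one pair coefficient. [this work] -/
theorem twoLoad_plus_identity (p π c m x y : ℝ) :
    (π * (x * (x * p * (1 - p) + y * c) ^ 2) + p * (y * (y * π * (1 - π) + x * c) ^ 2))
      + p * π * (x ^ 3 * p * (1 - p ^ 2) + y ^ 3 * π * (1 - π ^ 2))
      - p * π * (2 * x ^ 3 * p * (1 - p) + 2 * y ^ 3 * π * (1 - π) + 2 * x * y * c * (x + y) + 4 * x * y * m * (x * p + y * π))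
      = (c ^ 2 - 2 * p * π * c - 4 * p * π * m) * (x * y * (p * x + π * y)) := by
  ring

/-- Endpoint certificate (case `π ≤ p`, `c = π(1−p)`):
`p·[πp²(1−p²)x³ + pπ²(1−π²)y³ − π²(1−p)(1−3p)xy(px+πy)] = π(1−p²)(px+πy)(px−πy)² + π²(p²−π²)y³ + 4p²π²(1−p)xy(px+πy)`.
[this work] -/
theorem twoLoad_endpoint_identity (p π x y : ℝ) :
    p * (π * p ^ 2 * (1 - p ^ 2) * x ^ 3 + p * π ^ 2 * (1 - π ^ 2) * y ^ 3
        - π ^ 2 * (1 - p) * (1 - 3 * p) * (x * y * (p * x + π * y)))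
      = π * (1 - p ^ 2) * (p * x + π * y) * (p * x - π * y) ^ 2 + π ^ 2 * (p ^ 2 - π ^ 2) * y ^ 3
        + 4 * p ^ 2 * π ^ 2 * (1 - p) * (x * y * (p * x + π * y)) := by
  ring

/-- The gap is nonnegative in the ordered case `π ≤ p` (the other case is the same statement with `(p,x)` and `(π,y)`
exchanged).  Hypotheses: `0 ≤ π ≤ p ≤ 1`, `0 ≤ c ≤ π(1−p)`, `m, x, y ≥ 0`. [this work] -/
theorem twoLoad_gap_nonneg_of_le (p π c m x y : ℝ) (hπ0 : 0 ≤ π) (hπp : π ≤ p) (hp1 : p ≤ 1)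
    (hc0 : 0 ≤ c) (hc : c ≤ π * (1 - p)) (hm : 0 ≤ m) (hx : 0 ≤ x) (hy : 0 ≤ y) :
    0 ≤ π * p ^ 2 * (1 - p ^ 2) * x ^ 3 + p * π ^ 2 * (1 - π ^ 2) * y ^ 3
        + (2 * p * π * c + 4 * p * π * m - c ^ 2) * (x * y * (p * x + π * y)) := by
  have hp0 : 0 ≤ p := le_trans hπ0 hπp
  have hπ1 : π ≤ 1 := le_trans hπp hp1
  have hM : 0 ≤ x * y * (p * x + π * y) := by positivity
  have hK : 0 ≤ π * p ^ 2 * (1 - p ^ 2) * x ^ 3 + p * π ^ 2 * (1 - π ^ 2) * y ^ 3 := by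
    have h1 : 0 ≤ 1 - p ^ 2 := by nlinarith
    have h2 : 0 ≤ 1 - π ^ 2 := by nlinarith
    positivity
  have hmt : 0 ≤ 4 * p * π * m * (x * y * (p * x + π * y)) := by positivity
  -- the `c`-dependent factor is concave in `c`; compare with the endpoint value at `c₁ = π(1−p)`
  by_cases hcase : 0 ≤ 2 * p * π * c - c ^ 2
  · have : 0 ≤ (2 * p * π * c - c ^ 2) * (x * y * (p * x + π * y)) := mul_nonneg hcase hM
    nlinarith [this]
  · push Not at hcase
    -- here `c > 2pπ`, so `φ(c) = 2pπc − c² ≥ φ(c₁)` for `c ≤ c₁ = π(1−p)`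
    have hφ : 2 * p * π * (π * (1 - p)) - (π * (1 - p)) ^ 2 ≤ 2 * p * π * c - c ^ 2 := by
      have hcc : c > 2 * p * π := by nlinarith
      nlinarith [mul_nonneg (sub_nonneg.2 hc) (by nlinarith : (0:ℝ) ≤ c + π * (1 - p) - 2 * p * π)]
    -- endpoint value is nonnegative by the explicit certificate
    have hE : 0 ≤ p * (π * p ^ 2 * (1 - p ^ 2) * x ^ 3 + p * π ^ 2 * (1 - π ^ 2) * y ^ 3
        - π ^ 2 * (1 - p) * (1 - 3 * p) * (x * y * (p * x + π * y))) := by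
      rw [twoLoad_endpoint_identity]
      have h1 : 0 ≤ 1 - p ^ 2 := by nlinarith
      have h2 : 0 ≤ p ^ 2 - π ^ 2 := by nlinarith
      have h3 : 0 ≤ 1 - p := by linarith
      have h4 : 0 ≤ p * x + π * y := by positivity
      positivity
    have hE' : 0 ≤ π * p ^ 2 * (1 - p ^ 2) * x ^ 3 + p * π ^ 2 * (1 - π ^ 2) * y ^ 3
        + (2 * p * π * (π * (1 - p)) - (π * (1 - p)) ^ 2) * (x * y * (p * x + π * y)) := by
      have hid : (2 * p * π * (π * (1 - p)) - (π * (1 - p)) ^ 2) = -(π ^ 2 * (1 - p) * (1 - 3 * p)) := by ring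
      rw [hid]
      by_cases hp : 0 < p
      · have := hE
        have h' : 0 ≤ π * p ^ 2 * (1 - p ^ 2) * x ^ 3 + p * π ^ 2 * (1 - π ^ 2) * y ^ 3
            - π ^ 2 * (1 - p) * (1 - 3 * p) * (x * y * (p * x + π * y)) := by
          by_contra hneg
          push Not at hneg
          have : p * (π * p ^ 2 * (1 - p ^ 2) * x ^ 3 + p * π ^ 2 * (1 - π ^ 2) * y ^ 3
              - π ^ 2 * (1 - p) * (1 - 3 * p) * (x * y * (p * x + π * y))) < 0 := mul_neg_of_pos_of_neg hp hneg
          linarith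
        linarith
      · have hp00 : p = 0 := le_antisymm (not_lt.1 hp) hp0
        have hπ00 : π = 0 := le_antisymm (hp00 ▸ hπp) hπ0
        subst hp00; subst hπ00; simp
    have hmono : (2 * p * π * (π * (1 - p)) - (π * (1 - p)) ^ 2) * (x * y * (p * x + π * y))
        ≤ (2 * p * π * c - c ^ 2) * (x * y * (p * x + π * y)) := mul_le_mul_of_nonneg_right hφ hM
    nlinarith [hmono, hE', hmt]

/-- **Two-load (V_w), algebraic core.**  For `0 ≤ p, π ≤ 1`, `pπ ≤ τ ≤ min(p, π)`, `m, x, y ≥ 0`: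
`π·x(xp(1−p) + y(τ−pπ))² + p·y(yπ(1−π) + x(τ−pπ))² ≤ pπ·[2x³p(1−p) + 2y³π(1−π) + 2xy(τ−pπ)(x+y) + 4xym(xp+yπ)]`,
i.e. `pπ·W ≤ pπ·2|Cov(L,R)|`. [this work] -/
theorem twoLoad_gap_nonneg (p π τ m x y : ℝ) (hp0 : 0 ≤ p) (hp1 : p ≤ 1) (hπ0 : 0 ≤ π) (hπ1 : π ≤ 1)
    (hH : p * π ≤ τ) (hτp : τ ≤ p) (hτπ : τ ≤ π) (hm : 0 ≤ m) (hx : 0 ≤ x) (hy : 0 ≤ y) :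
    π * (x * (x * p * (1 - p) + y * (τ - p * π)) ^ 2) + p * (y * (y * π * (1 - π) + x * (τ - p * π)) ^ 2)
      ≤ p * π * (2 * x ^ 3 * p * (1 - p) + 2 * y ^ 3 * π * (1 - π) + 2 * x * y * (τ - p * π) * (x + y)
          + 4 * x * y * m * (x * p + y * π)) := by
  rw [← sub_nonneg, twoLoad_gap_identity]
  rcases le_total π p with hπp | hpπ
  · exact twoLoad_gap_nonneg_of_le p π (τ - p * π) m x y hπ0 hπp hp1 (by linarith) (by nlinarith) hm hx hy
  · -- exchange the roles of `(p, x)` and `(π, y)`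
    have h := twoLoad_gap_nonneg_of_le π p (τ - p * π) m y x hp0 hpπ hπ1 (by linarith) (by nlinarith) hm hy hx
    have hid : π * p ^ 2 * (1 - p ^ 2) * x ^ 3 + p * π ^ 2 * (1 - π ^ 2) * y ^ 3
        + (2 * p * π * (τ - p * π) + 4 * p * π * m - (τ - p * π) ^ 2) * (x * y * (p * x + π * y))
        = p * π ^ 2 * (1 - π ^ 2) * y ^ 3 + π * p ^ 2 * (1 - p ^ 2) * x ^ 3
        + (2 * π * p * (τ - p * π) + 4 * π * p * m - (τ - p * π) ^ 2) * (y * x * (π * y + p * x)) := by ring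
    rw [hid]
    exact h

/-- Division form of `twoLoad_gap_nonneg` for `p, π > 0`: `W ≤ 2|Cov(L,R)|` written out for two loads. [this work] -/
theorem twoLoad_vw_alg (p π τ m x y : ℝ) (hp0 : 0 < p) (hp1 : p ≤ 1) (hπ0 : 0 < π) (hπ1 : π ≤ 1)
    (hH : p * π ≤ τ) (hτp : τ ≤ p) (hτπ : τ ≤ π) (hm : 0 ≤ m) (hx : 0 ≤ x) (hy : 0 ≤ y) :
    x * (x * p * (1 - p) + y * (τ - p * π)) ^ 2 / p + y * (y * π * (1 - π) + x * (τ - p * π)) ^ 2 / π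
      ≤ 2 * x ^ 3 * p * (1 - p) + 2 * y ^ 3 * π * (1 - π) + 2 * x * y * (τ - p * π) * (x + y)
          + 4 * x * y * m * (x * p + y * π) := by
  have h := twoLoad_gap_nonneg p π τ m x y hp0.le hp1 hπ0.le hπ1 hH hτp hτπ hm hx hy
  have hpπ : 0 < p * π := mul_pos hp0 hπ0
  rw [div_add_div _ _ hp0.ne' hπ0.ne', div_le_iff₀ hpπ]
  have hid : x * (x * p * (1 - p) + y * (τ - p * π)) ^ 2 * π + p * (y * (y * π * (1 - π) + x * (τ - p * π)) ^ 2)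
      = π * (x * (x * p * (1 - p) + y * (τ - p * π)) ^ 2) + p * (y * (y * π * (1 - π) + x * (τ - p * π)) ^ 2) := by ring
  rw [hid]
  nlinarith [h]

/-! ### The sharp form for two loads is a three-point inequality -/

/-- **(V_w⁺) for two loads ⟺ a three-point inequality.**  With `c = τ − pπ` and `s = τ + m` (`= μ(u↔b)`), for `p, π > 0`:
`c² − 2pπc − 4pπm ≤ 0 ↔ τ² + 3p²π² ≤ 4pπ(τ + m)`. [this work] -/
theorem vwPlus_twoLoad_iff_threePoint (p π τ m : ℝ) :
    (τ - p * π) ^ 2 - 2 * p * π * (τ - p * π) - 4 * p * π * m ≤ 0 ↔ τ ^ 2 + 3 * p ^ 2 * π ^ 2 ≤ 4 * p * π * (τ + m) := by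
  constructor <;> intro h <;> nlinarith [h]

/-- **The three-point inequality implies a Gladkov-type bound with constant 4**: `τ² + 3P² ≤ 4Ps ⟹ τ² ≤ 4Ps` (`P = pπ`,
`s = μ(u↔b)`); compare `P(abc)² ≤ 8P(ab)P(ac)P(bc)` (Gladkov, arXiv:2408.08457, Thm 6.2). [this work] -/
theorem gladkov4_of_threePoint (τ P s : ℝ) (h : τ ^ 2 + 3 * P ^ 2 ≤ 4 * P * s) : τ ^ 2 ≤ 4 * P * s := by
  nlinarith [sq_nonneg P]

/-- **A Gladkov-type bound with constant 3 implies the three-point inequality**: if `0 ≤ P ≤ τ ≤ s` (Harris and monotonicity)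
and `τ² ≤ 3Ps` then `τ² + 3P² ≤ 4Ps`.  (Case `τ ≤ 3P`: `4Ps ≥ 4Pτ ≥ τ² + 3P²` since `(τ−P)(τ−3P) ≤ 0`; case `τ ≥ 3P`:
`4Ps ≥ (4/3)τ² ≥ τ² + 3P²`.) [this work] -/
theorem threePoint_of_gladkov3 (τ P s : ℝ) (hP : 0 ≤ P) (hPτ : P ≤ τ) (hτs : τ ≤ s) (h3 : τ ^ 2 ≤ 3 * P * s) :
    τ ^ 2 + 3 * P ^ 2 ≤ 4 * P * s := by
  rcases le_total τ (3 * P) with hle | hge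
  · nlinarith [mul_nonneg (sub_nonneg.2 hPτ) (sub_nonneg.2 hle), mul_le_mul_of_nonneg_left hτs hP]
  · nlinarith [h3, mul_nonneg hP (sub_nonneg.2 hge)]

/-! ### The percolation statement -/

variable {V : Type*} [Fintype V] (w : Sym2 V → unitInterval) (s u b : V)

/-- **(V_w) for two loaded vertices on every finite weighted graph.**  For `μ = prodBernoulli w`, apex `s`, vertices `u, b`,
loads `x, y ≥ 0` at `u, b`: with `p = μ(s↔u)`, `π = μ(s↔b)`, `τ = μ(s↔u ∩ s↔b)`, `m = μ(u↔b ∩ (s↔u)ᶜ)`,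
`π·x(xp(1−p) + y(τ−pπ))² + p·y(yπ(1−π) + x(τ−pπ))² ≤ pπ·[2x³p(1−p) + 2y³π(1−π) + 2xy(τ−pπ)(x+y) + 4xym(xp+yπ)]`,
which is `pπ·W ≤ pπ·2|Cov(L,R)|` for `L = x1[s↔u] + y1[s↔b]` (memo §1).  Inputs: Harris (`prodBernoulli_harris`) and monotonicity.
[this work] -/
theorem twoLoad_vw (x y : ℝ) (hx : 0 ≤ x) (hy : 0 ≤ y) :
    (prodBernoulli w).real (openConn s b : Set (BondConfig V)) *
        (x * (x * (prodBernoulli w).real (openConn s u : Set (BondConfig V)) *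
              (1 - (prodBernoulli w).real (openConn s u : Set (BondConfig V))) +
            y * ((prodBernoulli w).real ((openConn s u : Set (BondConfig V)) ∩ (openConn s b : Set (BondConfig V))) -
              (prodBernoulli w).real (openConn s u : Set (BondConfig V)) *
                (prodBernoulli w).real (openConn s b : Set (BondConfig V)))) ^ 2) +
      (prodBernoulli w).real (openConn s u : Set (BondConfig V)) *
        (y * (y * (prodBernoulli w).real (openConn s b : Set (BondConfig V)) *
              (1 - (prodBernoulli w).real (openConn s b : Set (BondConfig V))) +
            x * ((prodBernoulli w).real ((openConn s u : Set (BondConfig V)) ∩ (openConn s b : Set (BondConfig V))) -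
              (prodBernoulli w).real (openConn s u : Set (BondConfig V)) *
                (prodBernoulli w).real (openConn s b : Set (BondConfig V)))) ^ 2)
      ≤ (prodBernoulli w).real (openConn s u : Set (BondConfig V)) *
          (prodBernoulli w).real (openConn s b : Set (BondConfig V)) *
        (2 * x ^ 3 * (prodBernoulli w).real (openConn s u : Set (BondConfig V)) *
              (1 - (prodBernoulli w).real (openConn s u : Set (BondConfig V))) +
            2 * y ^ 3 * (prodBernoulli w).real (openConn s b : Set (BondConfig V)) *
              (1 - (prodBernoulli w).real (openConn s b : Set (BondConfig V))) +
            2 * x * y * ((prodBernoulli w).real ((openConn s u : Set (BondConfig V)) ∩ (openConn s b : Set (BondConfig V))) -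
              (prodBernoulli w).real (openConn s u : Set (BondConfig V)) *
                (prodBernoulli w).real (openConn s b : Set (BondConfig V))) * (x + y) +
          4 * x * y * (prodBernoulli w).real ((openConn u b : Set (BondConfig V)) ∩ (openConn s u : Set (BondConfig V))ᶜ) *
            (x * (prodBernoulli w).real (openConn s u : Set (BondConfig V)) +
              y * (prodBernoulli w).real (openConn s b : Set (BondConfig V)))) := by
  set μ := prodBernoulli w with hμ
  set p := μ.real (openConn s u : Set (BondConfig V)) with hp
  set π := μ.real (openConn s b : Set (BondConfig V)) with hπ
  set τ := μ.real ((openConn s u : Set (BondConfig V)) ∩ (openConn s b : Set (BondConfig V))) with hτ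
  set m := μ.real ((openConn u b : Set (BondConfig V)) ∩ (openConn s u : Set (BondConfig V))ᶜ) with hm
  have hp0 : 0 ≤ p := measureReal_nonneg
  have hπ0 : 0 ≤ π := measureReal_nonneg
  have hm0 : 0 ≤ m := measureReal_nonneg
  have hp1 : p ≤ 1 := measureReal_le_one
  have hπ1 : π ≤ 1 := measureReal_le_one
  have hτp : τ ≤ p := measureReal_mono Set.inter_subset_left
  have hτπ : τ ≤ π := measureReal_mono Set.inter_subset_right
  have hH : p * π ≤ τ :=
    prodBernoulli_harris w (isUpperSet_openConn s u) (isUpperSet_openConn s b)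
      MeasurableSet.of_discrete MeasurableSet.of_discrete
  exact twoLoad_gap_nonneg p π τ m x y hp0 hp1 hπ0 hπ1 hH hτp hτπ hm0 hx hy

end APL

end Summit.CriticalPhenomena.PercolationContinuityZ3.Theorems

/-! ### Consequence for the sharp form: (V_w⁺) for two loads forces a Gladkov-type constant 4 -/

namespace Summit.CriticalPhenomena.PercolationContinuityZ3.Theorems

namespace APL

open MeasureTheory Set Literature.Probability.Percolation Literature.Probability.LatticeModels
open scoped Classical

variable {V : Type*} [Fintype V] (w : Sym2 V → unitInterval) (s u b : V)

/-- `μ(u↔b) = μ(s↔u ∩ s↔b) + μ(u↔b ∩ (s↔u)ᶜ)`: `u` and `b` are joined either through the cluster of `s` (then both are in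
it) or off it. [this work] -/
theorem real_openConn_eq_tau_add_off :
    (prodBernoulli w).real (openConn u b : Set (BondConfig V)) =
      (prodBernoulli w).real ((openConn s u : Set (BondConfig V)) ∩ (openConn s b : Set (BondConfig V))) +
        (prodBernoulli w).real ((openConn u b : Set (BondConfig V)) ∩ (openConn s u : Set (BondConfig V))ᶜ) := by
  have h := measureReal_inter_add_sdiff (μ := prodBernoulli w) (s := (openConn u b : Set (BondConfig V)))
    (t := (openConn s u : Set (BondConfig V))) MeasurableSet.of_discrete (measure_ne_top _ _)
  rw [Set.sdiff_eq, openConn_vx_inter_sv s u b] at h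
  linarith

/-- **(V_w⁺) for two loaded vertices ⟹ the three-point inequality ⟹ a Gladkov-type bound with constant 4.**
If the sharp inequality `W + Φ ≤ 2|Cov(L,R)|` holds at `(s; u, b)` for ALL two-vertex loads `x, y ≥ 0` (written out and
multiplied by `pπ`, as in `twoLoad_vw`), and `μ(s↔u), μ(s↔b) > 0`, then
`μ(s↔u ∩ s↔b)² + 3 μ(s↔u)²μ(s↔b)² ≤ 4 μ(s↔u) μ(s↔b) μ(u↔b)`, in particular `μ(s↔u↔b)² ≤ 4 μ(s↔u)μ(s↔b)μ(u↔b)`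
(the published constant for general graphs is `8`: Gladkov, arXiv:2408.08457, Thm 6.2; conversely constant `3` would give the
hypothesis back, `threePoint_of_gladkov3`).  So any proof of (V_w⁺) on all finite graphs improves that constant to `4`. [this work] -/
theorem threePoint_of_vwPlus_twoLoad
    (hp : 0 < (prodBernoulli w).real (openConn s u : Set (BondConfig V)))
    (hπ : 0 < (prodBernoulli w).real (openConn s b : Set (BondConfig V)))
    (hplus : ∀ x y : ℝ, 0 ≤ x → 0 ≤ y →
      (prodBernoulli w).real (openConn s b : Set (BondConfig V)) *
          (x * (x * (prodBernoulli w).real (openConn s u : Set (BondConfig V)) *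
                (1 - (prodBernoulli w).real (openConn s u : Set (BondConfig V))) +
              y * ((prodBernoulli w).real ((openConn s u : Set (BondConfig V)) ∩ (openConn s b : Set (BondConfig V))) -
                (prodBernoulli w).real (openConn s u : Set (BondConfig V)) *
                  (prodBernoulli w).real (openConn s b : Set (BondConfig V)))) ^ 2) +
        (prodBernoulli w).real (openConn s u : Set (BondConfig V)) *
          (y * (y * (prodBernoulli w).real (openConn s b : Set (BondConfig V)) *
                (1 - (prodBernoulli w).real (openConn s b : Set (BondConfig V))) +
              x * ((prodBernoulli w).real ((openConn s u : Set (BondConfig V)) ∩ (openConn s b : Set (BondConfig V))) -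
                (prodBernoulli w).real (openConn s u : Set (BondConfig V)) *
                  (prodBernoulli w).real (openConn s b : Set (BondConfig V)))) ^ 2)
        + (prodBernoulli w).real (openConn s u : Set (BondConfig V)) *
            (prodBernoulli w).real (openConn s b : Set (BondConfig V)) *
          (x ^ 3 * (prodBernoulli w).real (openConn s u : Set (BondConfig V)) *
              (1 - (prodBernoulli w).real (openConn s u : Set (BondConfig V)) ^ 2) +
            y ^ 3 * (prodBernoulli w).real (openConn s b : Set (BondConfig V)) *
              (1 - (prodBernoulli w).real (openConn s b : Set (BondConfig V)) ^ 2))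
      ≤ (prodBernoulli w).real (openConn s u : Set (BondConfig V)) *
            (prodBernoulli w).real (openConn s b : Set (BondConfig V)) *
          (2 * x ^ 3 * (prodBernoulli w).real (openConn s u : Set (BondConfig V)) *
                (1 - (prodBernoulli w).real (openConn s u : Set (BondConfig V))) +
              2 * y ^ 3 * (prodBernoulli w).real (openConn s b : Set (BondConfig V)) *
                (1 - (prodBernoulli w).real (openConn s b : Set (BondConfig V))) +
              2 * x * y * ((prodBernoulli w).real ((openConn s u : Set (BondConfig V)) ∩ (openConn s b : Set (BondConfig V))) -
                (prodBernoulli w).real (openConn s u : Set (BondConfig V)) *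
                  (prodBernoulli w).real (openConn s b : Set (BondConfig V))) * (x + y) +
            4 * x * y * (prodBernoulli w).real ((openConn u b : Set (BondConfig V)) ∩ (openConn s u : Set (BondConfig V))ᶜ) *
              (x * (prodBernoulli w).real (openConn s u : Set (BondConfig V)) +
                y * (prodBernoulli w).real (openConn s b : Set (BondConfig V))))) :
    (prodBernoulli w).real ((openConn s u : Set (BondConfig V)) ∩ (openConn s b : Set (BondConfig V))) ^ 2 +
        3 * (prodBernoulli w).real (openConn s u : Set (BondConfig V)) ^ 2 *
          (prodBernoulli w).real (openConn s b : Set (BondConfig V)) ^ 2 ≤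
      4 * (prodBernoulli w).real (openConn s u : Set (BondConfig V)) *
        (prodBernoulli w).real (openConn s b : Set (BondConfig V)) *
        (prodBernoulli w).real (openConn u b : Set (BondConfig V)) := by
  set μ := prodBernoulli w with hμ
  set p := μ.real (openConn s u : Set (BondConfig V)) with hp'
  set π := μ.real (openConn s b : Set (BondConfig V)) with hπ'
  set τ := μ.real ((openConn s u : Set (BondConfig V)) ∩ (openConn s b : Set (BondConfig V))) with hτ
  set m := μ.real ((openConn u b : Set (BondConfig V)) ∩ (openConn s u : Set (BondConfig V))ᶜ) with hm
  have hs : μ.real (openConn u b : Set (BondConfig V)) = τ + m := real_openConn_eq_tau_add_off w s u b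
  rw [hs]
  -- the hypothesis at `x = y = 1`, rewritten through the sharp-form identity
  have h1 := hplus 1 1 zero_le_one zero_le_one
  have hid := twoLoad_plus_identity p π (τ - p * π) m 1 1
  have hkey : ((τ - p * π) ^ 2 - 2 * p * π * (τ - p * π) - 4 * p * π * m) * (1 * 1 * (p * 1 + π * 1)) ≤ 0 := by
    rw [← hid]
    nlinarith [h1]
  have hsum : 0 < p + π := by linarith
  have hcoef : (τ - p * π) ^ 2 - 2 * p * π * (τ - p * π) - 4 * p * π * m ≤ 0 := by
    by_contra hneg
    push Not at hneg
    have : 0 < ((τ - p * π) ^ 2 - 2 * p * π * (τ - p * π) - 4 * p * π * m) * (1 * 1 * (p * 1 + π * 1)) := by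
      have hpos : 0 < (1 : ℝ) * 1 * (p * 1 + π * 1) := by nlinarith
      exact mul_pos hneg hpos
    linarith
  exact (vwPlus_twoLoad_iff_threePoint p π τ m).1 hcoef

/-- **Corollary: (V_w⁺) for two loads ⟹ `μ(s↔u↔b)² ≤ 4 μ(s↔u) μ(s↔b) μ(u↔b)`** (Gladkov-type, constant `4` < the published `8`).
[this work] -/
theorem gladkov4_of_vwPlus_twoLoad
    (hp : 0 < (prodBernoulli w).real (openConn s u : Set (BondConfig V)))
    (hπ : 0 < (prodBernoulli w).real (openConn s b : Set (BondConfig V)))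
    (hplus : ∀ x y : ℝ, 0 ≤ x → 0 ≤ y →
      (prodBernoulli w).real (openConn s b : Set (BondConfig V)) *
          (x * (x * (prodBernoulli w).real (openConn s u : Set (BondConfig V)) *
                (1 - (prodBernoulli w).real (openConn s u : Set (BondConfig V))) +
              y * ((prodBernoulli w).real ((openConn s u : Set (BondConfig V)) ∩ (openConn s b : Set (BondConfig V))) -
                (prodBernoulli w).real (openConn s u : Set (BondConfig V)) *
                  (prodBernoulli w).real (openConn s b : Set (BondConfig V)))) ^ 2) +
        (prodBernoulli w).real (openConn s u : Set (BondConfig V)) *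
          (y * (y * (prodBernoulli w).real (openConn s b : Set (BondConfig V)) *
                (1 - (prodBernoulli w).real (openConn s b : Set (BondConfig V))) +
              x * ((prodBernoulli w).real ((openConn s u : Set (BondConfig V)) ∩ (openConn s b : Set (BondConfig V))) -
                (prodBernoulli w).real (openConn s u : Set (BondConfig V)) *
                  (prodBernoulli w).real (openConn s b : Set (BondConfig V)))) ^ 2)
        + (prodBernoulli w).real (openConn s u : Set (BondConfig V)) *
            (prodBernoulli w).real (openConn s b : Set (BondConfig V)) *
          (x ^ 3 * (prodBernoulli w).real (openConn s u : Set (BondConfig V)) *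
              (1 - (prodBernoulli w).real (openConn s u : Set (BondConfig V)) ^ 2) +
            y ^ 3 * (prodBernoulli w).real (openConn s b : Set (BondConfig V)) *
              (1 - (prodBernoulli w).real (openConn s b : Set (BondConfig V)) ^ 2))
      ≤ (prodBernoulli w).real (openConn s u : Set (BondConfig V)) *
            (prodBernoulli w).real (openConn s b : Set (BondConfig V)) *
          (2 * x ^ 3 * (prodBernoulli w).real (openConn s u : Set (BondConfig V)) *
                (1 - (prodBernoulli w).real (openConn s u : Set (BondConfig V))) +
              2 * y ^ 3 * (prodBernoulli w).real (openConn s b : Set (BondConfig V)) *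
                (1 - (prodBernoulli w).real (openConn s b : Set (BondConfig V))) +
              2 * x * y * ((prodBernoulli w).real ((openConn s u : Set (BondConfig V)) ∩ (openConn s b : Set (BondConfig V))) -
                (prodBernoulli w).real (openConn s u : Set (BondConfig V)) *
                  (prodBernoulli w).real (openConn s b : Set (BondConfig V))) * (x + y) +
            4 * x * y * (prodBernoulli w).real ((openConn u b : Set (BondConfig V)) ∩ (openConn s u : Set (BondConfig V))ᶜ) *
              (x * (prodBernoulli w).real (openConn s u : Set (BondConfig V)) +
                y * (prodBernoulli w).real (openConn s b : Set (BondConfig V))))) :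
    (prodBernoulli w).real ((openConn s u : Set (BondConfig V)) ∩ (openConn s b : Set (BondConfig V))) ^ 2 ≤
      4 * (prodBernoulli w).real (openConn s u : Set (BondConfig V)) *
        (prodBernoulli w).real (openConn s b : Set (BondConfig V)) *
        (prodBernoulli w).real (openConn u b : Set (BondConfig V)) := by
  have h := threePoint_of_vwPlus_twoLoad w s u b hp hπ hplus
  nlinarith [h, sq_nonneg ((prodBernoulli w).real (openConn s u : Set (BondConfig V)) *
    (prodBernoulli w).real (openConn s b : Set (BondConfig V)))]

end APL

end Summit.CriticalPhenomena.PercolationContinuityZ3.Theorems
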